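import Literature.AlgebraicGeometry.ModuliOfAbelianVarieties.SiegelFamilyProductLociGenusTwo
import Literature.Geometry.Kaehler.ComplexTorusAntisymplecticGraphComplementaryPair
import HarnessLib

/-!
# Debarre's twisted products `(Y × Z)/graph(p)` are points of the Noether–Lefschetz loci `NL_{g,δ}`
# (Iribar López 2024, Lemma 10 and Definition 4)

Layer `Literature/AlgebraicGeometry/ModuliOfAbelianVarieties`, namespace
`Literature.AlgebraicGeometry.ModuliOfAbelianVarieties.SiegelModuli`; lane `lit-hodgefound` (Track 2 foundations
library, Layer A4), seat `lit-hodgefound-skel-4` (gen 26), row **A4-76**, FILE C.  Sequel of the two Kähler-layer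
files of the row, `ComplexTorusAntisymplecticGraphQuotient.lean` (FILE A: `(Y × Z)/graph(p)` is principally
polarised by the descended `θ_p = p₁^*ω₁ + p₂^*ω₂`) and `ComplexTorusAntisymplecticGraphComplementaryPair.lean`
(FILE B: `Y' = π(Y × 0)`, `Z' = π(0 × Z)` are complementary abelian subvarieties with induced types the types of
`ω₁`, `ω₂`), and of rows A4-74/A4-75 (`nlLocusType g δ = NL_{g,δ}` on `𝔥_g`,
`exists_isPolarizedIso_prinPeriod_of_isPrincipalPolarization` = Thm. 3.1.2 at `D = 1_g`,
`isSubPolarizationType_map_toLin'`, `nlLocusType_two_eq_humbertLocusPrim_sq`).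

Source followed: A. Iribar López, *Noether–Lefschetz cycles on the moduli space of abelian varieties*, Forum Math. Pi
(2026), held text `paper:arxiv-2411.09910`, §2.2 pp. 7–8, VERBATIM: "**Lemma 10.** With notation as above, for
any antisymplectic isomorphism `p : K(θ_Y) → K(θ_Z)`, the abelian variety `(Y × Z)/graph(p)` has a canonical
principal polarization `θ_p` and contains `(Y, θ_Y)`, `(Z, θ_Z)` as complementary subvarieties. […]
**Definition 4.** If `u ≤ g/2` and `δ = (d₁, …, d_u)` is a polarization type, define the morphism
`𝒫_{g,δ} : 𝒜^{lev}_{u,δ} × 𝒜^{lev}_{g−u,δ̃} → 𝒜_g` sending the pair `((Y, θ_Y, f_Y), (Z, θ_Z, f_Z))` to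
`((Y × Z)/graph(f_Z ∘ r ∘ f_Y⁻¹), θ_{f_Z ∘ r ∘ f_Y⁻¹})`, where `r : K(δ) → K(δ̃) = K(δ)` is the antisymplectic
isomorphism that exchanges the factors […]. By Lemma 10, `𝒫_{g,δ}` is surjective onto the locus of principally
polarized abelian varieties having a subvariety whose induced type is of type `δ`."  And §1.2 p. 3:
"`NL_{g,δ} = {(A, θ) ∈ 𝒜_g ∣ A has an abelian subvariety B and θ|_B is of type δ}`".

## Lean rendering

`𝒜_g` is read on the period domain: `Sp_{2g}(ℤ)∖𝔥_g`, a p.p.a.v. of dimension `g` being `(X_W, E_W)`,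
`W ∈ 𝔥_g` (`prinPeriod W`, `prinForm W`), up to `IsPolarizedIso`; the value `𝒫_{g,δ}(Y, Z, p)` is any `W ∈ 𝔥_g`
with `((Y × Z)/graph(p), θ_p) ≅ (X_W, E_W)` (it exists by Thm. 3.1.2, is unique up to `Sp_{2g}(ℤ)` by Prop. 3.1.4,
and `nlLocusType` is `Sp_{2g}(ℤ)`-stable, row A4-75).  The level structures `f_Y`, `f_Z` and `r` are absorbed into
the datum of the antisymplectic isomorphism `p` itself (`IsAntisymplectic ω₁ ω₂ p`, FILE A).

## Main statements (all proved; no definition, no named fact, net debt 0)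

* §1 **`exists_isPolarizedIso_prinPeriod_quotientBy_graphSubgroup`** — `((Y × Z)/graph(p), θ_p) ≅ (X_W, E_W)` for
  some `W ∈ 𝔥_g`, `2g = rk Λ_Y + rk Λ_Z`;
* §2 `mem_nlLocusType_of_isPolarizedIso_of_isSubPolarizationType` (transport from an arbitrary polarised torus),
  **`mem_nlLocusType_of_isPolarizedIso_quotientBy_graphSubgroup`** (`W ∈ NL_{g,δ}`, `δ` the type of `θ_Y`),
  **`mem_nlLocusType_of_isPolarizedIso_quotientBy_graphSubgroup'`** (`W ∈ NL_{g,δ'}`, `δ'` the type of `θ_Z`),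
  **`exists_mem_nlLocusType_isPolarizedIso_quotientBy_graphSubgroup`** (assembled: `image(𝒫_{g,δ}) ⊆ NL_{g,δ} ∩ NL_{g,δ'}`),
  `add_eq_of_isPolarizationType` (`u + v = g`);
* §3 validation `g = 2`: **`mem_humbertLocusPrim_sq_of_isPolarizedIso_quotientBy_graphSubgroup`** — the twisted
  product of two elliptic curves along an antisymplectic `p : E₁[ω₁] ≅ E₂[ω₂]`, `ω₁` of type `(d)`, lies on the
  Humbert surface `H_{d²}` (`NL_{2,(d)} = H_{d²}`, row A4-74).

NOT here: the surjectivity «all principally polarized abelian varieties having `Y` and `Z` as complementary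
subvarieties arise this way» (the addition isogeny `Y × Y^⊥ → X`, p10's `ComplexTorusComplementaryAdditionIsogeny`),
"does not depend on `p`", the existence of antisymplectic isomorphisms for prescribed complementary types, stacks.

## References

* [IribarLopez2024NoetherLefschetzCycles] A. Iribar López, Forum Math. Pi (2026), arXiv:2411.09910, §1.2 (p. 3), §2.2
  Lemma 10, Def. 4 (pp. 7–8).
* [Auffarth2016NonSimplePPAV] R. Auffarth, Math. Z. 282 (2016) 731–746, §3 (Debarre's morphism `Φ_{u,n−u}(D)`).
* [Lange2023AbelianVarietiesComplex] H. Lange, *Abelian Varieties over the Complex Numbers* (2023), §3.1.1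
  Thm. 3.1.2 (p. 158), §3.1.2 Prop. 3.1.4 (pp. 159–160).
* [Kani1994EllipticCurvesAbelianSurfaces] E. Kani, *Elliptic curves on abelian surfaces*, Manuscripta Math. 84
  (1994), §1 (Humbert surfaces `H_{N²}`).
-/

noncomputable section

open Matrix Module Function Set

namespace Literature.AlgebraicGeometry.ModuliOfAbelianVarieties

namespace SiegelModuli

open Literature.NumberTheory.Automorphic (siegelUpperHalfSpace)
open Literature.NumberTheory.ModularForms.SiegelUpperHalfSpace
open Literature.Geometry.Kaehler Literature.Geometry.Kaehler.ComplexTorus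

variable {g u v : ℕ}

variable {ι₁ ι₂ : Type*} [Fintype ι₁] [Fintype ι₂] [DecidableEq ι₁] [DecidableEq ι₂] {E₁ E₂ : Type*}
  [NormedAddCommGroup E₁] [NormedSpace ℂ E₁] [NormedAddCommGroup E₂] [NormedSpace ℂ E₂]
  {Φ₁ : (ι₁ → ℝ) ≃L[ℝ] E₁} {Φ₂ : (ι₂ → ℝ) ≃L[ℝ] E₂} {ω₁ : E₁ [⋀^Fin 2]→L[ℝ] ℝ} {ω₂ : E₂ [⋀^Fin 2]→L[ℝ] ℝ}
  {G₁ : Matrix ι₁ ι₁ ℤ} {G₂ : Matrix ι₂ ι₂ ℤ}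
  (hω₁ : IsRiemannForm Φ₁ ω₁) (hω₂ : IsRiemannForm Φ₂ ω₂)
  (hG₁ : G₁.map (Int.cast : ℤ → ℝ) = latticeGram Φ₁ ω₁) (hG₂ : G₂.map (Int.cast : ℤ → ℝ) = latticeGram Φ₂ ω₂)
  {p : kerPhiH Φ₁ G₁ →+ kerPhiH Φ₂ G₂} (hp : Bijective p) (ha : IsAntisymplectic ω₁ ω₂ p)

/-! ## §1 The twisted product `(Y × Z)/graph(p)` is a point of the Siegel family `𝔥_g`, `2g = rk Λ_Y + rk Λ_Z` -/

include hω₁ hω₂ hG₁ hG₂ hp ha in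
/-- **Debarre's twisted product is a point of `𝒜_g`**: for polarised tori `(Y, ω₁)`, `(Z, ω₂)` with
`rk Λ_Y + rk Λ_Z = 2g` and an antisymplectic isomorphism `p : K(L₁) → K(L₂)`, the principally polarised torus
`((Y × Z)/graph(p), θ_p)` is isomorphic, as a POLARISED torus, to a member `(X_W, E_W)` of the principal Siegel
family, `W ∈ 𝔥_g` (Thm. 3.1.2 for the principal polarisation `θ_p` of FILE A) — the value of Iribar López's
morphism `𝒫_{g,δ} : 𝒜^{lev}_{u,δ} × 𝒜^{lev}_{g−u,δ̃} → 𝒜_g`, `((Y, θ_Y, f_Y), (Z, θ_Z, f_Z)) ↦ ((Y × Z)/graph(f_Z ∘ r ∘ f_Y⁻¹), θ)`,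
at the pair, read in `𝒜_g = Sp_{2g}(ℤ)∖𝔥_g`. [cite: IribarLopez2024NoetherLefschetzCycles, §2.2 Lemma 10 and Def. 4 (pp. 7–8)] [cite: Lange2023AbelianVarietiesComplex, §3.1.1 Thm. 3.1.2 (p. 158)] -/
theorem exists_isPolarizedIso_prinPeriod_quotientBy_graphSubgroup
    [Finite (graphSubgroup (kerPhiH Φ₁ G₁) (kerPhiH Φ₂ G₂) p)] (hg : Fintype.card ι₁ + Fintype.card ι₂ = 2 * g) :
    ∃ (W : siegelUpperHalfSpace g)
      (h : ComplexTorus (quotientByPeriod (prodPeriod Φ₁ Φ₂) (graphSubgroup (kerPhiH Φ₁ G₁) (kerPhiH Φ₂ G₂) p)) ≃+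
        ComplexTorus (prinPeriod W : (Fin g ⊕ Fin g → ℝ) ≃L[ℝ] (Fin g → ℂ))),
      IsPolarizedIso (quotientByPeriod (prodPeriod Φ₁ Φ₂) (graphSubgroup (kerPhiH Φ₁ G₁) (kerPhiH Φ₂ G₂) p))
        (prodForm ω₁ ω₂) (prinPeriod W : (Fin g ⊕ Fin g → ℝ) ≃L[ℝ] (Fin g → ℂ)) (prinForm W) h :=
  exists_isPolarizedIso_prinPeriod_of_isPrincipalPolarization _
    (isPrincipalPolarization_quotientBy_graphSubgroup hω₁ hω₂ hG₁ hG₂ hp ha) (by rw [Fintype.card_sum, hg])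

/-! ## §2 Every Siegel point of the twisted product lies in `NL_{g,δ}` and in `NL_{g,δ'}` -/

section Transport

variable {ι : Type*} [Fintype ι] [DecidableEq ι] {E : Type*} [NormedAddCommGroup E] [NormedSpace ℂ E]
  {Ψ : (ι → ℝ) ≃L[ℝ] E} {η : E [⋀^Fin 2]→L[ℝ] ℝ}

/-- **An abelian subvariety with induced polarization of type `δ` is carried to `NL_{g,δ}` by an isomorphism of
polarised tori onto a Siegel member**: if `(X, η) ≅ (X_W, E_W)` and `X` has a lattice subspace `U`, complex for `Ψ`,
with `η|_U` of type `δ`, then `W ∈ NL_{g,δ}` (transport of `U` along `ρ(A)⁻¹ = ρ(B)`, as in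
`mem_nlLocusType_of_isPolarizedIso`, for an arbitrary source torus).
[cite: IribarLopez2024NoetherLefschetzCycles, §1.2 ("`NL_{g,δ} = {(A, θ) ∈ 𝒜_g ∣ A has an abelian subvariety B and θ|_B is of type δ}`", p. 3)] [cite: Lange2023AbelianVarietiesComplex, §3.1.2 Prop. 3.1.4 (pp. 159–160)] -/
theorem mem_nlLocusType_of_isPolarizedIso_of_isSubPolarizationType {W : siegelUpperHalfSpace g}
    {h : ComplexTorus Ψ ≃+ ComplexTorus (prinPeriod W : (Fin g ⊕ Fin g → ℝ) ≃L[ℝ] (Fin g → ℂ))}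
    (hh : IsPolarizedIso Ψ η (prinPeriod W : (Fin g ⊕ Fin g → ℝ) ≃L[ℝ] (Fin g → ℂ)) (prinForm W) h)
    {U : Submodule ℝ (ι → ℝ)} (hU : IsLatticeSubspace U) (hUc : IsComplexSubspace Ψ U) {δ : Fin u → ℕ}
    (hd : IsSubPolarizationType Ψ η U δ) : W ∈ nlLocusType g δ := by
  obtain ⟨A, B, C, hBA, hAB, -, -, hC, hform⟩ := hh.symm.exists_matrix
  exact ⟨_, hU.map_toLin' B, hUc.map_toLin' hBA hAB C hC, isSubPolarizationType_map_toLin' hBA hAB C hC hform hd⟩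

end Transport

include hω₁ hG₁ hG₂ ha in
/-- **The twisted product lies in `NL_{g,δ}`, `δ` the type of `(Y, ω₁)`**: for any isomorphism of polarised tori
`((Y × Z)/graph(p), θ_p) ≅ (X_W, E_W)`, `W ∈ 𝔥_g`, the point `W` lies in Iribar López's `NL_{g,δ}` — the abelian
subvariety is `Y' = π(Y × 0)` with `θ_p|_{Y'}` of the type `δ` of `ω₁` (FILE B). ("`𝒫_{g,δ}` is surjective onto the
locus of principally polarized abelian varieties having a subvariety whose induced type is of type `δ`" — here the
inclusion `image(𝒫_{g,δ}) ⊆ NL_{g,δ}`.) [cite: IribarLopez2024NoetherLefschetzCycles, §2.2 Lemma 10 and Def. 4 (pp. 7–8), §1.2 (p. 3)] -/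
theorem mem_nlLocusType_of_isPolarizedIso_quotientBy_graphSubgroup
    [Finite (graphSubgroup (kerPhiH Φ₁ G₁) (kerPhiH Φ₂ G₂) p)] {δ : Fin u → ℕ} (hδ : ComplexTorus.IsPolarizationType Φ₁ ω₁ δ)
    {W : siegelUpperHalfSpace g}
    {h : ComplexTorus (quotientByPeriod (prodPeriod Φ₁ Φ₂) (graphSubgroup (kerPhiH Φ₁ G₁) (kerPhiH Φ₂ G₂) p)) ≃+
      ComplexTorus (prinPeriod W : (Fin g ⊕ Fin g → ℝ) ≃L[ℝ] (Fin g → ℂ))}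
    (hh : IsPolarizedIso (quotientByPeriod (prodPeriod Φ₁ Φ₂) (graphSubgroup (kerPhiH Φ₁ G₁) (kerPhiH Φ₂ G₂) p))
      (prodForm ω₁ ω₂) (prinPeriod W : (Fin g ⊕ Fin g → ℝ) ≃L[ℝ] (Fin g → ℂ)) (prinForm W) h) :
    W ∈ nlLocusType g δ :=
  mem_nlLocusType_of_isPolarizedIso_of_isSubPolarizationType hh (isLatticeSubspace_fstSubspace_map_graph p)
    (isComplexSubspace_fstSubspace_map_graph p)
    ((isSubPolarizationType_fstSubspace_map_graph_iff ω₁ ω₂ p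
      (ha.injective hG₁ (hω₁.det_intGram_ne_zero hG₁) hG₂) δ).2 hδ)

/-- **The twisted product lies in `NL_{g,δ'}`, `δ'` the type of `(Z, ω₂)`** (the abelian subvariety `Z' = π(0 × Z)`).
[cite: IribarLopez2024NoetherLefschetzCycles, §2.2 Lemma 10 ("contains `(Z, θ_Z)`") and §1.2 (p. 3)] -/
theorem mem_nlLocusType_of_isPolarizedIso_quotientBy_graphSubgroup' {K₁ : AddSubgroup (ComplexTorus Φ₁)}
    {K₂ : AddSubgroup (ComplexTorus Φ₂)} (q : K₁ →+ K₂) [Finite (graphSubgroup K₁ K₂ q)] {δ' : Fin v → ℕ}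
    (hδ' : ComplexTorus.IsPolarizationType Φ₂ ω₂ δ') {W : siegelUpperHalfSpace g}
    {h : ComplexTorus (quotientByPeriod (prodPeriod Φ₁ Φ₂) (graphSubgroup K₁ K₂ q)) ≃+
      ComplexTorus (prinPeriod W : (Fin g ⊕ Fin g → ℝ) ≃L[ℝ] (Fin g → ℂ))}
    (hh : IsPolarizedIso (quotientByPeriod (prodPeriod Φ₁ Φ₂) (graphSubgroup K₁ K₂ q))
      (prodForm ω₁ ω₂) (prinPeriod W : (Fin g ⊕ Fin g → ℝ) ≃L[ℝ] (Fin g → ℂ)) (prinForm W) h) :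
    W ∈ nlLocusType g δ' :=
  mem_nlLocusType_of_isPolarizedIso_of_isSubPolarizationType hh (isLatticeSubspace_sndSubspace_map_graph q)
    (isComplexSubspace_sndSubspace_map_graph q) ((isSubPolarizationType_sndSubspace_map_graph_iff ω₁ ω₂ q δ').2 hδ')

include hω₁ hω₂ hG₁ hG₂ hp ha in
/-- **Iribar López 2024, Lemma 10 / Def. 4 on `𝔥_g`: the twisted product `(Y × Z)/graph(p)` gives a point of
`NL_{g,δ} ∩ NL_{g,δ'}`** (`δ` the type of `θ_Y = ω₁`, `δ'` the type of `θ_Z = ω₂`; `rk Λ_Y + rk Λ_Z = 2g`): there are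
`W ∈ 𝔥_g` and an isomorphism of polarised tori `((Y × Z)/graph(p), θ_p) ≅ (X_W, E_W)`, and every such `W` lies in
both Noether–Lefschetz loci. [cite: IribarLopez2024NoetherLefschetzCycles, §2.2 Lemma 10 and Def. 4 (pp. 7–8)] [cite: Auffarth2016NonSimplePPAV, §3 (Debarre's morphism `Φ_{u,n−u}(D) : 𝒜_u(D) × 𝒜_{n−u}(D̃) → 𝒜^D_{u,n−u}`)] -/
theorem exists_mem_nlLocusType_isPolarizedIso_quotientBy_graphSubgroup
    [Finite (graphSubgroup (kerPhiH Φ₁ G₁) (kerPhiH Φ₂ G₂) p)] (hg : Fintype.card ι₁ + Fintype.card ι₂ = 2 * g)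
    {δ : Fin u → ℕ} (hδ : ComplexTorus.IsPolarizationType Φ₁ ω₁ δ) {δ' : Fin v → ℕ} (hδ' : ComplexTorus.IsPolarizationType Φ₂ ω₂ δ') :
    ∃ (W : siegelUpperHalfSpace g)
      (h : ComplexTorus (quotientByPeriod (prodPeriod Φ₁ Φ₂) (graphSubgroup (kerPhiH Φ₁ G₁) (kerPhiH Φ₂ G₂) p)) ≃+
        ComplexTorus (prinPeriod W : (Fin g ⊕ Fin g → ℝ) ≃L[ℝ] (Fin g → ℂ))),
      IsPolarizedIso (quotientByPeriod (prodPeriod Φ₁ Φ₂) (graphSubgroup (kerPhiH Φ₁ G₁) (kerPhiH Φ₂ G₂) p))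
          (prodForm ω₁ ω₂) (prinPeriod W : (Fin g ⊕ Fin g → ℝ) ≃L[ℝ] (Fin g → ℂ)) (prinForm W) h ∧
        W ∈ nlLocusType g δ ∧ W ∈ nlLocusType g δ' := by
  obtain ⟨W, h, hh⟩ := exists_isPolarizedIso_prinPeriod_quotientBy_graphSubgroup hω₁ hω₂ hG₁ hG₂ hp ha hg
  exact ⟨W, h, hh, mem_nlLocusType_of_isPolarizedIso_quotientBy_graphSubgroup hω₁ hG₁ hG₂ ha hδ hh,
    mem_nlLocusType_of_isPolarizedIso_quotientBy_graphSubgroup' p hδ' hh⟩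

omit [DecidableEq ι₁] [DecidableEq ι₂] in
/-- The dimension bookkeeping of the twisted product: `u + v = g` for the types `δ` (length `u = dim Y`) and `δ'`
(length `v = dim Z`). [cite: IribarLopez2024NoetherLefschetzCycles, §2.2 ("It has dimension `g − u`"), p. 7] -/
theorem add_eq_of_isPolarizationType (hg : Fintype.card ι₁ + Fintype.card ι₂ = 2 * g) {δ : Fin u → ℕ}
    (hδ : ComplexTorus.IsPolarizationType Φ₁ ω₁ δ) {δ' : Fin v → ℕ} (hδ' : ComplexTorus.IsPolarizationType Φ₂ ω₂ δ') : u + v = g := by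
  have h1 := hδ.card_eq
  have h2 := hδ'.card_eq
  omega

/-! ## §3 Validation (`g = 2`, `u = v = 1`): twisted products of elliptic curves lie on the Humbert surface
`H_{d²}` -/

include hω₁ hG₁ hG₂ ha in
/-- **`(E₁ × E₂)/graph(p)` lies on the Humbert surface of invariant `d²`** when `(E₁, ω₁)` is an elliptic curve
polarised with type `(d)` (`rk Λ₁ = rk Λ₂ = 2`): `NL_{2,(d)} = H_{d²}` (row A4-74,
`nlLocusType_two_eq_humbertLocusPrim_sq`) — the degree-`d²` isogeny `E₁ × E₂ → X` of the classical theory.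
[cite: IribarLopez2024NoetherLefschetzCycles, §1.2 ("When `g = 2`, the Noether-Lefschetz locus … Humbert surfaces", p. 4) and §2.2 Lemma 10] [cite: Kani1994EllipticCurvesAbelianSurfaces, §1 (the Humbert surface `H_{N²}`)] -/
theorem mem_humbertLocusPrim_sq_of_isPolarizedIso_quotientBy_graphSubgroup
    [Finite (graphSubgroup (kerPhiH Φ₁ G₁) (kerPhiH Φ₂ G₂) p)] {d : ℕ} (hδ : ComplexTorus.IsPolarizationType Φ₁ ω₁ ![d])
    {W : siegelUpperHalfSpace 2}
    {h : ComplexTorus (quotientByPeriod (prodPeriod Φ₁ Φ₂) (graphSubgroup (kerPhiH Φ₁ G₁) (kerPhiH Φ₂ G₂) p)) ≃+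
      ComplexTorus (prinPeriod W : (Fin 2 ⊕ Fin 2 → ℝ) ≃L[ℝ] (Fin 2 → ℂ))}
    (hh : IsPolarizedIso (quotientByPeriod (prodPeriod Φ₁ Φ₂) (graphSubgroup (kerPhiH Φ₁ G₁) (kerPhiH Φ₂ G₂) p))
      (prodForm ω₁ ω₂) (prinPeriod W : (Fin 2 ⊕ Fin 2 → ℝ) ≃L[ℝ] (Fin 2 → ℂ)) (prinForm W) h) :
    W ∈ humbertLocusPrim ((d : ℤ) ^ 2) := by
  have hd : 0 < d := hδ.pos hω₁ 0
  rw [← nlLocusType_two_eq_humbertLocusPrim_sq hd]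
  exact mem_nlLocusType_of_isPolarizedIso_quotientBy_graphSubgroup hω₁ hG₁ hG₂ ha hδ hh

end SiegelModuli

end Literature.AlgebraicGeometry.ModuliOfAbelianVarieties

end
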